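import Literature.AlgebraicGeometry.Frobenioids.Frobenioid
import Literature.AlgebraicGeometry.Frobenioids.PreFrobenioidDataOfFunctor
import Literature.AlgebraicGeometry.Frobenioids.DivisorMonoidCategoryTheoreticity
import Literature.AlgebraicGeometry.Frobenioids.CategoryTheoreticityFacts
import HarnessLib

/-!
# Frobenioids I, Corollary 4.11 (ii) — PROOF of the group-like case modulo the typed Theorem 3.4 (v)

Mochizuki, *The geometry of Frobenioids I: the general theory*, Kyushu J. Math. **62** (2008)
293–400, kurims text Cor. 4.11 pp. 91–94 [cite: MochizukiFrdI2008, Cor. 4.11 (ii) p.91].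

PROOF-ONLY companion of `DivisorMonoidCategoryTheoreticity.lean` (seat abc-iut-L1-t3; the typed
conclusion predicates `PreFrobenioidData.Cor411ii`, `PreFrobenioidData.Thm34v`). The printed proof of
Cor. 4.11 opens (p. 92): "if `C₁`, `C₂` are of group-like type [cf. Theorem 3.4, (ii)], then
'Div-slimness' amounts to 'slimness', so assertions (i), (ii) follow from Theorem 3.4, (iv), (v)". This
file kernel-checks exactly that reduction for (ii):

* `mon_eq_one_of_isOfGroupLikeType`: if `C` is of group-like type and every object of `D` is isomorphic
  to some `Base(A)` (Def. 1.3 (i)(a)), every divisor monoid `Φ(X)` is trivial;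
* `isSlim_of_isDivSlim_of_isOfGroupLikeType`: hence "Div-slim amounts to slim" (via the PROVED first
  claim of Ex. 4.7 (i), `isDivSlim_iff_isSlim_of_trivial_on_aut`);
* `cor411ii_of_thm34v_of_isOfGroupLikeType`: Cor. 4.11 (ii) for `C₁`, `C₂` of group-like type, from the
  typed conclusion of Thm. 3.4 (v) for `Ψ` — generic over `PreFrobenioidData`;
* `cor411ii_groupLike_of_fact`: the same for Frobenioids `C_i → F_{Φ_i}` (`ofFunctor`), conditional only
  on the named fact `FrdI.Thm34v`.

Honest conditional discharge: the inputs are t3's typed predicates, the glue is proved; the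
non-group-like case (via `C^birat`, Cor. 4.10, Prop. 3.11 (iii)) is not in this file. No statement of
the paper is strengthened.
-/

namespace Literature.AlgebraicGeometry.Frobenioids

open CategoryTheory Opposite

universe w w₁ w₂ v v' v₁ v₁' v₂ v₂' u u' u₁ u₁' u₂ u₂'

namespace PreFrobenioidData

section OneFrobenioid

variable {C : Type u} [Category.{v} C] {D : Type u'} [Category.{v'} D] (S : PreFrobenioidData.{w} C D)

/-- If `C` is of group-like type and every object of `D` is isomorphic to some `Base(A)` (Def. 1.3 (i)(a)),
then every divisor monoid `Φ(X)`, `X ∈ Ob(D)`, is trivial ("Div-slimness amounts to slimness", FrdI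
proof of Cor. 4.11 p. 92). [cite: MochizukiFrdI2008, Cor. 4.11 p.92] -/
theorem mon_eq_one_of_isOfGroupLikeType (hbase : ∀ X : D, ∃ A : C, Nonempty (S.base.obj A ≅ X))
    (hgl : S.IsOfGroupLikeType) (X : D) (x : S.Mon X) : x = 1 := by
  obtain ⟨A, ⟨e⟩⟩ := hbase X
  have h1 : S.pull e.hom x = 1 := hgl.obj A _
  calc x = S.pull (𝟙 X) x := (S.pull_id X x).symm
    _ = S.pull (e.inv ≫ e.hom) x := by rw [e.inv_hom_id]
    _ = S.pull e.inv (S.pull e.hom x) := S.pull_comp _ _ _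
    _ = 1 := by rw [h1, map_one]

/-- "If `C₁`, `C₂` are of group-like type, then 'Div-slimness' amounts to 'slimness'" (FrdI proof of
Cor. 4.11 p. 92): for `C` of group-like type with every object of `D` isomorphic to a `Base(A)`, `D`
Div-slim implies `D` slim. [cite: MochizukiFrdI2008, Cor. 4.11 p.92] -/
theorem isSlim_of_isDivSlim_of_isOfGroupLikeType (hbase : ∀ X : D, ∃ A : C, Nonempty (S.base.obj A ≅ X))
    (hgl : S.IsOfGroupLikeType) (h : S.IsDivSlim) : IsSlim D :=
  (S.isDivSlim_iff_isSlim_of_trivial_on_aut fun X f _ x => by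
      rw [S.mon_eq_one_of_isOfGroupLikeType hbase hgl X x, map_one]).1 h

end OneFrobenioid

section TwoFrobenioids

variable {C₁ : Type u₁} [Category.{v₁} C₁] {D₁ : Type u₁'} [Category.{v₁'} D₁]
variable {C₂ : Type u₂} [Category.{v₂} C₂] {D₂ : Type u₂'} [Category.{v₂'} D₂]
variable (S₁ : PreFrobenioidData.{w₁} C₁ D₁) (S₂ : PreFrobenioidData.{w₂} C₂ D₂) (Ψ : C₁ ≌ C₂)

/-- **Corollary 4.11 (ii), group-like case**, DISCHARGED modulo the typed Thm. 3.4 (v): if `C₁`, `C₂` are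
of group-like type and every object of `D_i` is isomorphic to some `Base(A)` (Def. 1.3 (i)(a)), then the
conclusion of Thm. 3.4 (v) for `Ψ` yields Cor. 4.11 (ii) for `Ψ` — Div-slimness of the `D_i` gives their
slimness, so Thm. 3.4 (v) supplies the `1`-unique `Ψ^Base` and the rigidity of the composites (FrdI
p. 92: "assertions (i), (ii) follow from Theorem 3.4, (iv), (v)"). [cite: MochizukiFrdI2008, Cor. 4.11 (ii) p.91] -/
theorem cor411ii_of_thm34v_of_isOfGroupLikeType
    (hbase₁ : ∀ X : D₁, ∃ A : C₁, Nonempty (S₁.base.obj A ≅ X))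
    (hbase₂ : ∀ X : D₂, ∃ A : C₂, Nonempty (S₂.base.obj A ≅ X))
    (hgl₁ : S₁.IsOfGroupLikeType) (hgl₂ : S₂.IsOfGroupLikeType) (h34v : Thm34v S₁ S₂ Ψ) :
    Cor411ii S₁ S₂ Ψ := by
  intro hs
  have hsl₁ : IsSlim D₁ := S₁.isSlim_of_isDivSlim_of_isOfGroupLikeType hbase₁ hgl₁ hs.divSlim.1
  have hsl₂ : IsSlim D₂ := S₂.isSlim_of_isDivSlim_of_isOfGroupLikeType hbase₂ hgl₂ hs.divSlim.2
  obtain ⟨-, -, ΨBase, hsq, hr₁, hr₂⟩ := h34v hs.standard.1 hs.standard.2 hs.hypB hsl₁ hsl₂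
  exact ⟨ΨBase, hsq, fun _ _ => ⟨hr₁, hr₂⟩⟩

end TwoFrobenioids

end PreFrobenioidData

namespace PreFrobenioid

section Facts

universe wf vf vf' uf uf'

variable {D₁ : Type uf} [Category.{vf} D₁] {Φ₁ : D₁ᵒᵖ ⥤ CommMonCat.{wf}}
  {C₁ : Type uf'} [Category.{vf'} C₁] (F₁ : C₁ ⥤ ElemFrobenioid Φ₁)
  {D₂ : Type uf} [Category.{vf} D₂] {Φ₂ : D₂ᵒᵖ ⥤ CommMonCat.{wf}}
  {C₂ : Type uf'} [Category.{vf'} C₂] (F₂ : C₂ ⥤ ElemFrobenioid Φ₂)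
  (Ψ : C₁ ≌ C₂)

/-- In a Frobenioid every object of the base category is isomorphic to some `Base(A)` (Def. 1.3 (i)(a),
with `A` Frobenius-trivial), in the operations rendering `ofFunctor`. [cite: MochizukiFrdI2008, Def. 1.3 (i) p.24] -/
theorem exists_base_iso_of_isFrobenioid (hF : IsFrobenioid F₁) (X : D₁) :
    ∃ A : C₁, Nonempty ((PreFrobenioidData.ofFunctor Φ₁ F₁).base.obj A ≅ X) := by
  obtain ⟨A, -, h⟩ := hF.i_a X
  exact ⟨A, h⟩

/-- **Corollary 4.11 (ii), group-like case** for Frobenioids `C_i → F_{Φ_i}` of group-like type,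
conditional only on the named fact [FrdI] Thm. 3.4 (v) (`FrdI.Thm34v`). [cite: MochizukiFrdI2008, Cor. 4.11 (ii) p.91] -/
theorem cor411ii_groupLike_of_fact (h34v : FrdI.Thm34v.{wf, vf, vf', uf, uf'}) (hF₁ : IsFrobenioid F₁)
    (hF₂ : IsFrobenioid F₂) (hgl₁ : (PreFrobenioidData.ofFunctor Φ₁ F₁).IsOfGroupLikeType)
    (hgl₂ : (PreFrobenioidData.ofFunctor Φ₂ F₂).IsOfGroupLikeType) :
    (PreFrobenioidData.ofFunctor Φ₁ F₁).Cor411ii (PreFrobenioidData.ofFunctor Φ₂ F₂) Ψ :=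
  PreFrobenioidData.cor411ii_of_thm34v_of_isOfGroupLikeType _ _ Ψ (exists_base_iso_of_isFrobenioid F₁ hF₁)
    (exists_base_iso_of_isFrobenioid F₂ hF₂) hgl₁ hgl₂ (h34v F₁ F₂ hF₁ hF₂ Ψ)

end Facts

end PreFrobenioid

end Literature.AlgebraicGeometry.Frobenioids
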